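import Summits.Ventures.CertifiedArithmetic.LowPrec.GemmThetaE5M2State
import Summits.Ventures.CertifiedArithmetic.LowPrec.GemmGridRounding120

/-!
# θ-certificate of E5M2²→bfloat16: structure lemmas of the state graph (soundness, part 1)

HONEST FRAMING (venture CertifiedArithmetic / cell `pub-lowprec`, seat gemm, gen 9): certified error
envelopes and provably optimal rounding/accumulation schemes for low-precision formats under stated
cost models; every table by two implementations; no hardware or vendor claims.

Paper `gemm.tex` §Regimes Prop. Θ(i), instance E5M2·E5M2→`bfloat16`: the letter-independent facts
behind the compressed certificate of `GemmThetaE5M2Defs.lean`, from the kernel-checked tables of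
`GemmThetaE5M2State.lean` and the bridge `GemmGridRounding120.lean` (states reach `2^72` grid units, so
the `|K| < 2^120` bridge is used throughout): `valG` strictly increasing and `Φ` nondecreasing
(`valG_lt_valG`, `psiZ_sval_mono`, `F_mono`), the absorption windows (`window_absorbs`: every offset
in `[-qlo, qhi]` is absorbed, by the monotonicity of `rne8`) and their propagation along runs and
parity classes (`aLo_le_qlo`).  This is the E5M2² instance of `GemmThetaE4M3Sound.lean` (same proofs,
the constants of the 64-binade graph).  Part 2: `GemmThetaE5M2Blocks.lean`; part 3:
`GemmThetaE5M2Cover.lean`.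
-/

namespace Literature.ComputerArithmetic.FloatingPoint

namespace MiniFloat

namespace ThetaE5M2

/-! ### Sizes -/

/-- Every state magnitude is at most `2^72` grid units (`v ≤ 2^40`). [cell] -/
theorem valG_le (i : ℕ) : valG i ≤ 4722366482869645213696 := by
  unfold valG
  split_ifs with h1 h2
  · omega
  · have he : (i - 256) / 128 + 1 ≤ 64 := by omega
    calc (128 + (i - 256) % 128) * 2 ^ ((i - 256) / 128 + 1) ≤ 255 * 2 ^ 64 :=
          Nat.mul_le_mul (by omega) (Nat.pow_le_pow_right (by norm_num) he)
      _ ≤ 4722366482869645213696 := by norm_num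
  · exact le_rfl

/-- `sval false i = valG i` and `sval true i = -valG i` (E5M2² states, grid `2^-32`). [cell] -/
theorem sval_cases (i : ℕ) :
    sval false i = ((valG i : ℕ) : ℤ) ∧ sval true i = -((valG i : ℕ) : ℤ) := by
  simp [sval]

/-- `|sval σ i| = valG i` (E5M2² states). [cell] -/
theorem natAbs_sval_eq (i : ℕ) (σ : Bool) : (sval σ i).natAbs = valG i := by
  cases σ
  · rw [(sval_cases i).1]; simp
  · rw [(sval_cases i).2]; simp

/-- `|sval σ i| ≤ 2^72`. [cell] -/
theorem natAbs_sval_le (σ : Bool) (i : ℕ) : (sval σ i).natAbs ≤ 4722366482869645213696 :=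
  (natAbs_sval_eq i σ).le.trans (valG_le i)

/-- Every letter passes `startOK`, and there are `1211` letters. [cell certificate] -/
theorem starts_all : lamG.all startOK = true ∧ lamG.length = 1211 := by
  have h := starts_len_ok
  simp only [Bool.and_eq_true, beq_iff_eq] at h
  exact h

/-- There are `1211` letters. [cell] -/
theorem length_lamG : lamG.length = 1211 := starts_all.2

/-- Letters have magnitude at most `14123288431433875456 = 3758096384²` (`= 57344² · 2^32`). [cell] -/
theorem natAbs_le_of_mem_lamG {Q : ℤ} (hQ : Q ∈ lamG) : Q.natAbs ≤ 14123288431433875456 := by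
  have h := List.all_eq_true.mp starts_all.1 Q hQ
  unfold startOK at h
  simp only [Bool.and_eq_true, decide_eq_true_eq] at h
  exact h.2

/-- The bridge applies: `|V + Q| < 2^120` whenever both are at most `2^100`. [folklore] -/
theorem natAbs_add_lt120 {V Q : ℤ} (hV : V.natAbs ≤ 1267650600228229401496703205376)
    (hQ : Q.natAbs ≤ 1267650600228229401496703205376) : (V + Q).natAbs < 2 ^ 120 := by
  have : (V + Q).natAbs ≤ V.natAbs + Q.natAbs := Int.natAbs_add_le V Q
  norm_num; omega

/-- `32 ≤ 133`: the grid `2^-32` is within `bfloat16`'s exponent range. [folklore] -/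
theorem g32 : (32 : ℕ) ≤ 133 := by norm_num

/-! ### The value/potential chain -/

/-- One link of the chain. [cell certificate] -/
theorem monoChain_at {i : ℕ} (hi : i < 8448) :
    valG i < valG (i + 1) ∧ psiNat (valG i) ≤ psiNat (valG (i + 1)) := by
  have h := monoChain_ok
  unfold monoChainOK at h
  have h1 := List.all_eq_true.mp h i (List.mem_range'_1.mpr ⟨Nat.zero_le i, by omega⟩)
  simp only [Bool.and_eq_true, decide_eq_true_eq] at h1
  exact h1

/-- `valG` is strictly increasing on `0..8448`. [cell] -/
theorem valG_lt_valG {i j : ℕ} (hij : i < j) (hj : j ≤ 8448) : valG i < valG j := by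
  induction j with
  | zero => omega
  | succ j ih =>
    rcases Nat.lt_succ_iff_lt_or_eq.mp hij with h | h
    · exact lt_trans (ih h (by omega)) (monoChain_at (by omega)).1
    · subst h; exact (monoChain_at (by omega)).1

/-- `valG` is monotone on `0..8448`. [cell] -/
theorem valG_le_valG {i j : ℕ} (hij : i ≤ j) (hj : j ≤ 8448) : valG i ≤ valG j := by
  rcases eq_or_lt_of_le hij with h | h
  · rw [h]
  · exact (valG_lt_valG h hj).le

/-- `valG` is injective on `0..8448`. [cell] -/
theorem valG_inj {i j : ℕ} (hi : i ≤ 8448) (hj : j ≤ 8448) (h : valG i = valG j) : i = j := by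
  rcases lt_trichotomy i j with hlt | heq | hgt
  · exact absurd h (ne_of_lt (valG_lt_valG hlt hj))
  · exact heq
  · exact absurd h.symm (ne_of_lt (valG_lt_valG hgt hi))

/-- `Φ` is nondecreasing along the nonnegative states. [cell certificate] -/
theorem psiNat_valG_mono {i j : ℕ} (hij : i ≤ j) (hj : j ≤ 8448) :
    psiNat (valG i) ≤ psiNat (valG j) := by
  induction j with
  | zero => simp at hij; subst hij; exact le_rfl
  | succ j ih =>
    rcases Nat.lt_succ_iff_lt_or_eq.mp (Nat.lt_succ_iff.mpr hij) with h | h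
    · exact le_trans (ih (by omega) (by omega)) (monoChain_at (by omega)).2
    · subst h; exact le_rfl

/-- `Φ ≥ 0` on the nonnegative states. [cell] -/
theorem psiNat_valG_nonneg {i : ℕ} (hi : i ≤ 8448) : 0 ≤ psiNat (valG i) := by
  have h0 : psiNat (valG 0) = 0 := by decide
  rw [← h0]; exact psiNat_valG_mono (Nat.zero_le i) hi

/-- `Φ(v) = psiNat v` on the nonnegative states and `Φ(-v) = |v|`. [cell] -/
theorem psiZ_sval_cases (i : ℕ) :
    psiZ (sval false i) = psiNat (valG i) ∧ psiZ (sval true i) = ((valG i : ℕ) : ℤ) := by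
  constructor
  · rw [(sval_cases i).1]; unfold psiZ; rw [if_neg (by omega), Int.toNat_natCast]
  · rw [(sval_cases i).2]; unfold psiZ
    by_cases h : valG i = 0
    · rw [h]; decide
    · rw [if_pos (by omega)]; ring

/-- `Φ` is nondecreasing in the index on each sign. [cell] -/
theorem psiZ_sval_mono (σ : Bool) {i j : ℕ} (hij : i ≤ j) (hj : j ≤ 8448) :
    psiZ (sval σ i) ≤ psiZ (sval σ j) := by
  cases σ
  · rw [(psiZ_sval_cases i).1, (psiZ_sval_cases j).1]; exact psiNat_valG_mono hij hj
  · rw [(psiZ_sval_cases i).2, (psiZ_sval_cases j).2]; exact_mod_cast valG_le_valG hij hj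

/-- `F = Φ + id` IS MONOTONE on the signed states. [cell, gemm.tex §Regimes] -/
theorem F_mono {u w : ℤ} (h : u ≤ w) (hu : IsSt u) (hw : IsSt w) : psiZ u + u ≤ psiZ w + w := by
  obtain ⟨σ, i, hi, rfl⟩ := hu
  obtain ⟨τ, j, hj, rfl⟩ := hw
  have hpi := psiNat_valG_nonneg hi
  have hpj := psiNat_valG_nonneg hj
  have h0 : psiNat 0 = 0 := by decide
  cases σ <;> cases τ
  · rw [(psiZ_sval_cases i).1, (psiZ_sval_cases j).1]
    rw [(sval_cases i).1, (sval_cases j).1] at h ⊢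
    have hij : i ≤ j := by
      by_contra hc
      have := valG_lt_valG (not_le.mp hc) hi
      omega
    have := psiNat_valG_mono hij hj
    omega
  · rw [(psiZ_sval_cases i).1, (psiZ_sval_cases j).2]
    rw [(sval_cases i).1, (sval_cases j).2] at h ⊢
    have hi0 : valG i = 0 := by omega
    rw [hi0, h0]; omega
  · rw [(psiZ_sval_cases i).2, (psiZ_sval_cases j).1]
    rw [(sval_cases i).2, (sval_cases j).1] at h ⊢
    omega
  · rw [(psiZ_sval_cases i).2, (psiZ_sval_cases j).2]
    rw [(sval_cases i).2, (sval_cases j).2] at h ⊢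
    omega

/-! ### Absorption windows -/

/-- `winCore ≤ h`. [cell] -/
theorem winCore_le (h : ℕ) (st ev : Bool) : winCore st ev h ≤ h := by
  unfold winCore; split_ifs <;> omega

/-- `qlo ≤ 2^64` and `qhi ≤ 2^64`. [cell] -/
theorem qlo_le_qhi_le (σ : Bool) (i : ℕ) :
    qlo σ i ≤ 18446744073709551616 ∧ qhi σ i ≤ 18446744073709551616 := by
  unfold qlo qhi
  by_cases h1 : i < 256
  · rw [if_pos h1, if_pos h1]; omega
  rw [if_neg h1, if_neg h1]
  by_cases h2 : 8448 ≤ i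
  · rw [if_pos h2, if_pos h2]; cases σ <;> simp
  rw [if_neg h2, if_neg h2]
  have hb : blk i - 1 ≤ 63 := by
    unfold blk; rw [if_neg h1, if_pos (show i < 8448 by omega)]; omega
  have hp := (Nat.pow_le_pow_right (show 0 < 2 by norm_num) hb).trans
    (show 2 ^ 63 ≤ 18446744073709551616 by norm_num)
  exact ⟨(winCore_le _ _ _).trans hp, (winCore_le _ _ _).trans hp⟩

/-- The two window claims of a state, from the kernel-checked tables. [cell certificate] -/
theorem state_ok (σ : Bool) {i : ℕ} (hi : i ≤ 8448) :
    rne8 (sval σ i - ((qlo σ i : ℕ) : ℤ)) = sval σ i ∧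
      rne8 (sval σ i + ((qhi σ i : ℕ) : ℤ)) = sval σ i := by
  have get : ∀ {a l : ℕ}, statesOK a l = true → a ≤ i → i < a + l → stateOK σ i = true := by
    intro a l h1 h2 h3
    unfold statesOK at h1
    have h4 := List.all_eq_true.mp h1 i (List.mem_range'_1.mpr ⟨h2, h3⟩)
    rw [Bool.and_eq_true] at h4
    cases σ
    · exact h4.1
    · exact h4.2
  have h : stateOK σ i = true := by
    rcases Nat.lt_or_ge i 1300 with h1 | h1
    · exact get states_ok_0 (Nat.zero_le i) (by omega)
    rcases Nat.lt_or_ge i 2600 with h2 | h2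
    · exact get states_ok_1 h1 (by omega)
    rcases Nat.lt_or_ge i 3900 with h3 | h3
    · exact get states_ok_2 h2 (by omega)
    rcases Nat.lt_or_ge i 5200 with h4 | h4
    · exact get states_ok_3 h3 (by omega)
    rcases Nat.lt_or_ge i 6500 with h5 | h5
    · exact get states_ok_4 h4 (by omega)
    rcases Nat.lt_or_ge i 7800 with h6 | h6
    · exact get states_ok_5 h5 (by omega)
    · exact get states_ok_6 h6 (by omega)
  unfold stateOK at h
  simp only [Bool.and_eq_true, decide_eq_true_eq] at h
  exact h

/-- THE WINDOW LEMMA: every integer offset `Z ∈ [-qlo, qhi]` is absorbed at the state — `rne8` is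
monotone and the two ends are absorbed. [cell, gemm.tex §Regimes] -/
theorem window_absorbs (σ : Bool) {i : ℕ} (hi : i ≤ 8448) {Z : ℤ}
    (h1 : -((qlo σ i : ℕ) : ℤ) ≤ Z) (h2 : Z ≤ ((qhi σ i : ℕ) : ℤ)) :
    rne8 (sval σ i + Z) = sval σ i := by
  obtain ⟨hlo, hhi⟩ := state_ok σ hi
  have hV := natAbs_sval_le σ i
  obtain ⟨hq1, hq2⟩ := qlo_le_qhi_le σ i
  have b1 : (sval σ i - ((qlo σ i : ℕ) : ℤ)).natAbs < 2 ^ 120 := by omega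
  have b2 : (sval σ i + Z).natAbs < 2 ^ 120 := by omega
  have b3 : (sval σ i + ((qhi σ i : ℕ) : ℤ)).natAbs < 2 ^ 120 := by omega
  have m1 := rne8_mono120 b1 b2 (by omega)
  have m2 := rne8_mono120 b2 b3 (by omega)
  rw [hlo] at m1
  rw [hhi] at m2
  exact le_antisymm m2 m1

/-- A state is a `bfloat16` rounding (of itself minus its window). [cell] -/
theorem sval_eq_rne8 (σ : Bool) {i : ℕ} (hi : i ≤ 8448) :
    rne8 (sval σ i - ((qlo σ i : ℕ) : ℤ)) = sval σ i := (state_ok σ hi).1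

/-- A letter that moves a state lies outside its window: `min(qlo, qhi) + 1 ≤ |Z|`. [cell] -/
theorem moved_outside_window (σ : Bool) {j : ℕ} (hj : j ≤ 8448) {Z : ℤ}
    (hne : rne8 (sval σ j + Z) ≠ sval σ j) :
    ((min (qlo σ j) (qhi σ j) : ℕ) : ℤ) + 1 ≤ (Z.natAbs : ℤ) := by
  by_contra hc
  have hm1 := min_le_left (qlo σ j) (qhi σ j)
  have hm2 := min_le_right (qlo σ j) (qhi σ j)
  exact hne (window_absorbs σ hj (by omega) (by omega))

/-- One link of the window chains. [cell certificate] -/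
theorem winChain_at {p i : ℕ} (hp : p = 1 ∨ p = 2) (hi : i < 8449) (σ : Bool) :
    mlo σ p i ≤ mlo σ p (i + p) ∧ mhi σ p i ≤ mhi σ p (i + p) := by
  have get : ∀ {a l : ℕ}, winChainOK p a l = true → a ≤ i → i < a + l →
      mlo σ p i ≤ mlo σ p (i + p) ∧ mhi σ p i ≤ mhi σ p (i + p) := by
    intro a l h h2 h3
    unfold winChainOK at h
    have h1 := List.all_eq_true.mp h i (List.mem_range'_1.mpr ⟨h2, h3⟩)
    simp only [Bool.and_eq_true, decide_eq_true_eq] at h1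
    cases σ
    · exact ⟨h1.1.1.1, h1.1.2⟩
    · exact ⟨h1.1.1.2, h1.2⟩
  rcases hp with rfl | rfl
  · rcases Nat.lt_or_ge i 4225 with h1 | h1
    · exact get winChain_one_lo (Nat.zero_le i) (by omega)
    · exact get winChain_one_hi h1 (by omega)
  · rcases Nat.lt_or_ge i 4225 with h1 | h1
    · exact get winChain_two_lo (Nat.zero_le i) (by omega)
    · exact get winChain_two_hi h1 (by omega)

/-- The window chains, iterated. [cell] -/
theorem mlo_mhi_chain (σ : Bool) {p : ℕ} (hp : p = 1 ∨ p = 2) (i : ℕ) :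
    ∀ m : ℕ, i + p * m ≤ 8448 + p →
      mlo σ p i ≤ mlo σ p (i + p * m) ∧ mhi σ p i ≤ mhi σ p (i + p * m)
  | 0, _ => by simp
  | m + 1, h => by
      rw [Nat.mul_succ] at h
      obtain ⟨ih1, ih2⟩ := mlo_mhi_chain σ hp i m (by omega)
      obtain ⟨c1, c2⟩ := winChain_at hp (show i + p * m < 8449 by omega) σ
      rw [Nat.mul_succ, ← Nat.add_assoc]
      exact ⟨ih1.trans c1, ih2.trans c2⟩

/-- THE RUN/CLASS WINDOW BOUND: `aLo σ j₁ j₂ p` (`aHi`) bounds the window of every member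
`j₁ + p·m ≤ j₂` from below. [cell] -/
theorem aLo_le_qlo (σ : Bool) {p : ℕ} (hp : p = 1 ∨ p = 2) {j₁ j₂ : ℕ} (hj : j₂ ≤ 8448) (m : ℕ)
    (hm : j₁ + p * m ≤ j₂) :
    aLo σ j₁ j₂ p ≤ qlo σ (j₁ + p * m) ∧ aHi σ j₁ j₂ p ≤ qhi σ (j₁ + p * m) := by
  unfold aLo aHi
  rcases Nat.eq_zero_or_pos m with rfl | hm0
  · simp only [Nat.mul_zero, Nat.add_zero]
    constructor <;> (split_ifs <;> first | exact le_rfl | exact min_le_left _ _)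
  · have hpm : p ≤ p * m := Nat.le_mul_of_pos_right p hm0
    have hge : ¬ j₂ < j₁ + p := by omega
    rw [if_neg hge, if_neg hge]
    have e : p * (m - 1) + p = p * m := by
      rcases hp with rfl | rfl <;> omega
    obtain ⟨c1, c2⟩ := mlo_mhi_chain σ hp j₁ (m - 1) (by omega)
    unfold mlo at c1
    unfold mhi at c2
    rw [Nat.add_assoc, e] at c1 c2
    exact ⟨c1.trans (min_le_right _ _), c2.trans (min_le_right _ _)⟩

end ThetaE5M2

end MiniFloat

end Literature.ComputerArithmetic.FloatingPoint
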